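import Summits.BirchSwinnertonDyer.BirchSwinnertonDyer.Theorems.InertBadSignedBranchesInertBadAtThreeIstarZeroManinTwist
import Summits.BirchSwinnertonDyer.BirchSwinnertonDyer.Theorems.InertBadSignedBranchesCccOneLawOnTypeIstarZeroManinTwistOnType
import HarnessLib

/-!
# Route `InertBadSignedBranches` (rung K8), items 19223 / 19656: route T-KR on the signed type `(p, I₀*)`
# for EVERY curve at EVERY odd `p` — `BSD(W, p)` from `r_an = 1` + the pair's OWN lower half (or a
# certified `p`-adic unit `#Ш_an`), NO Manin datum, NO conductor bound, NO table
# (helper toward stmt-BirchSwinnertonDyer-19223; cell bsd-cm, seat bsd-cm-k8i-c2 g6; per-pair consumers of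
# the seat's `…ManinTwistOnType` / `…InertBadAtThreeIstarZeroManinTwist`; nothing booked)

WHAT. With the Kolyvagin upper half on the type now class-level at every `p ≥ 5`
(`missingUpperBoundAt_of_hasSignedLocalType_IstarZero`) and at `p = 3`
(`missingUpperBoundAt_three_of_hasSignedLocalType_IstarZero`), the per-pair closing shapes of x1b's
`X12/InertCoreEveryCurve.lean` (`p ≥ 11`) and `InertCoreEveryCurveCremona.lean` / k8i-c41's
`InertBadAtThreeEveryCurve.lean` (`p ∈ {3, 5, 7}`, conductor `≤ 130000` / `≤ 300000`) hold on the type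
with NO bound: for every globally minimal `W` of signed type `(p, I₀*)` with `r_an = 1`,
* `bsdp_of_hasSignedLocalType_IstarZero_of_lower` / `…_three_…` — `BSD(W, p) ⟸` the pair's OWN lower half;
* `bsdp_of_hasSignedLocalType_IstarZero_of_shaAn_unit` / `…_three_…` — `BSD(W, p) ⟸ #Ш_an(W) = q` with
  `ord_p q = 0` (route T-KR: the certified-unit `#Ш_an` datum closes the pair);
* `missingInputAt_of_hasSignedLocalType_IstarZero_of_shaAn_unit` / `…_three_…` — the leaf's typed
  missing input `X12.MissingInputAt W p` at such a pair.
All from the published facts `hGZ hKo hMN hGZK hmod hnf hFH hCM8 hMaz` (Mazur 1978 Cor. 4.1 in place of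
Edixhoven / Cremona / `opt_man` DATA). CENSUS NOTE (the planner's / x1b's words stand; nothing booked
here): the O10-PS pairs at `p ∈ {5, 7}` with `300000 < N < 5·10⁵`, whose T-KR closure carried a
per-pair Manin datum from Cremona's `opt_man` (DATA tier), now need only the `#Ш_an` unit datum.

HONEST LABEL: theorems only; CONDITIONAL on displayed published facts and per-pair data; 19223, 19656,
STEP L and O10 stay OPEN; nothing booked; BSD is asserted for no specific curve by this file.

References: B. Mazur, Invent. Math. 44 (1978) Cor. 4.1; A. Matar, J. Nekovář, JTNB 31 (2019) Thm. 0.3;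
R. L. Miller, LMS J. Comput. Math. 14 (2011) §1, Def. 1.1.
-/

set_option autoImplicit false
set_option linter.dupNamespace false

noncomputable section

open scoped Classical NumberField

open WeierstrassCurve NumberField IsDedekindDomain
open Literature.NumberTheory.EllipticCurves
open Literature.NumberTheory.EllipticCurves.ModularForms
open Literature.NumberTheory.EllipticCurves.Rank1Residual
open Literature.NumberTheory.EllipticCurves.Rank1Residual.Typed
open Summit.BirchSwinnertonDyer.Rank1Residual
open Summit.BirchSwinnertonDyer.Rank1Residual.X12.O10

namespace Summit.BirchSwinnertonDyer.BirchSwinnertonDyer.Theorems.CccOneManinTwist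

section Facts

variable
  (hGZ : ∀ (N : ℕ) [NeZero N] (W : WeierstrassCurve ℚ) (K : Type) [Field K] [NumberField K],
    gross_zagier N W K)
  (hKo : ∀ (N : ℕ) [NeZero N] (W : WeierstrassCurve ℚ) (K : Type) [Field K] [NumberField K],
    kolyvagin N W K)
  (hMN : ∀ (N : ℕ) [NeZero N] (W : WeierstrassCurve ℚ) (K : Type) [Field K] [NumberField K],
    MatarNekovar2019.thm03_padicValNat_card_sha_le_of_irreducible N W K)
  (hGZK : rank_eq_analyticRank_of_analyticRank_le_one) (hmod : hasEntireLFunction_rat)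
  (hnf : exists_isNewformOf) (hFH : friedbergHoffstein_exists_heegnerField_split_twist_ne_zero)
  (hCM8 : bsdTriple_of_hasCM_of_L_one_ne_zero) (hMaz : mazur_not_dvd_maninConstant_of_odd)

include hGZ hKo hMN hGZK hmod hnf hFH hCM8 hMaz

/-! ## §1 `p ≥ 5` -/

/-- **`BSD(W, p)` on the type `(p, I₀*)`, `p ≥ 5`, from the pair's OWN lower half** — every curve, every
conductor: lower (hypothesis) ∧ upper (`missingUpperBoundAt_of_hasSignedLocalType_IstarZero`) ⟹
`MissingPPartAt` ⟹ `BSDp` (GZK). CONDITIONAL; nothing booked. [cite: Mazur1978, Cor. 4.1]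
[cite: MatarNekovar2019, Thm. 0.3 and §0.11] [cite: Miller2011LMS, §1 and Def. 1.1] -/
theorem bsdp_of_hasSignedLocalType_IstarZero_of_lower (p : ℕ) [Fact p.Prime]
    (W : WeierstrassCurve ℚ) [W.IsElliptic] [W.IsGloballyMinimal] (hp5 : 5 ≤ p)
    (hT : HasSignedLocalType W p (.Istar 0)) (hr : W.analyticRank = 1) (hlow : MissingLowerBoundAt W p) :
    BSDp W p :=
  bsdp_of_missingPPartAt W p hGZK (by rw [hr])
    (missingPPartAt_of_lower_of_upper W p hlow
      (missingUpperBoundAt_of_hasSignedLocalType_IstarZero p hGZ hKo hMN hGZK hmod hnf hFH hCM8 hMaz W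
        hp5 hT hr))

/-- **Route T-KR on the type `(p, I₀*)`, `p ≥ 5`, every curve, every conductor**: `#Ш_an(W) = q` with
`ord_p q = 0` ⟹ `BSD(W, p)` (the lower half is then trivial, `X12.missingLowerBoundAt_of_shaAn_unit`).
CONDITIONAL on the per-pair datum and the facts; nothing booked. [cite: Mazur1978, Cor. 4.1]
[cite: Miller2011LMS, §1 and Def. 1.1] -/
theorem bsdp_of_hasSignedLocalType_IstarZero_of_shaAn_unit (p : ℕ) [Fact p.Prime]
    (W : WeierstrassCurve ℚ) [W.IsElliptic] [W.IsGloballyMinimal] (hp5 : 5 ≤ p)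
    (hT : HasSignedLocalType W p (.Istar 0)) (hr : W.analyticRank = 1) {q : ℚ}
    (hq : shaAn W = (q : ℂ)) (hv : padicValRat p q = 0) : BSDp W p :=
  bsdp_of_hasSignedLocalType_IstarZero_of_lower hGZ hKo hMN hGZK hmod hnf hFH hCM8 hMaz p W hp5 hT hr
    (X12.missingLowerBoundAt_of_shaAn_unit hq hv)

/-- **The leaf's typed missing input at a pair of the type with a certified unit `#Ш_an`**, `p ≥ 5`:
`X12.MissingInputAt W p`. CONDITIONAL; nothing booked. [cite: Mazur1978, Cor. 4.1]
[cite: Miller2011LMS, §1 and Def. 1.1] -/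
theorem missingInputAt_of_hasSignedLocalType_IstarZero_of_shaAn_unit (p : ℕ) [Fact p.Prime]
    (W : WeierstrassCurve ℚ) [W.IsElliptic] [W.IsGloballyMinimal] (hp5 : 5 ≤ p)
    (hT : HasSignedLocalType W p (.Istar 0)) (hr : W.analyticRank = 1) {q : ℚ}
    (hq : shaAn W = (q : ℂ)) (hv : padicValRat p q = 0) : X12.MissingInputAt W p :=
  fun _ ↦ missingPPartAt_of_lower_of_upper W p (X12.missingLowerBoundAt_of_shaAn_unit hq hv)
    (missingUpperBoundAt_of_hasSignedLocalType_IstarZero p hGZ hKo hMN hGZK hmod hnf hFH hCM8 hMaz W hp5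
      hT hr)

/-! ## §2 `p = 3` -/

/-- **`BSD(W, 3)` on the type `(3, I₀*)` from the pair's OWN lower half** — every curve, every
conductor. CONDITIONAL; nothing booked. [cite: Mazur1978, Cor. 4.1]
[cite: MatarNekovar2019, Thm. 0.3 and §0.11] [cite: Miller2011LMS, §1 and Def. 1.1] -/
theorem bsdp_three_of_hasSignedLocalType_IstarZero_of_lower
    (W : WeierstrassCurve ℚ) [W.IsElliptic] [W.IsGloballyMinimal] [Fact (Nat.Prime 3)]
    (hT : HasSignedLocalType W 3 (.Istar 0)) (hr : W.analyticRank = 1) (hlow : MissingLowerBoundAt W 3) :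
    BSDp W 3 :=
  bsdp_of_missingPPartAt W 3 hGZK (by rw [hr])
    (missingPPartAt_of_lower_of_upper W 3 hlow
      (missingUpperBoundAt_three_of_hasSignedLocalType_IstarZero hGZ hKo hMN hGZK hmod hnf hFH hCM8 hMaz W
        hT hr))

/-- **Route T-KR on the type `(3, I₀*)`, every curve, every conductor**: `#Ш_an(W) = q`, `ord₃ q = 0`
⟹ `BSD(W, 3)`. CONDITIONAL; nothing booked. [cite: Mazur1978, Cor. 4.1] [cite: Miller2011LMS, §1 and Def. 1.1] -/
theorem bsdp_three_of_hasSignedLocalType_IstarZero_of_shaAn_unit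
    (W : WeierstrassCurve ℚ) [W.IsElliptic] [W.IsGloballyMinimal] [Fact (Nat.Prime 3)]
    (hT : HasSignedLocalType W 3 (.Istar 0)) (hr : W.analyticRank = 1) {q : ℚ}
    (hq : shaAn W = (q : ℂ)) (hv : padicValRat 3 q = 0) : BSDp W 3 :=
  bsdp_three_of_hasSignedLocalType_IstarZero_of_lower hGZ hKo hMN hGZK hmod hnf hFH hCM8 hMaz W hT hr
    (X12.missingLowerBoundAt_of_shaAn_unit hq hv)

/-- **The leaf's typed missing input at a pair of the type `(3, I₀*)` with a certified unit `#Ш_an`**: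
`X12.MissingInputAt W 3`. CONDITIONAL; nothing booked. [cite: Mazur1978, Cor. 4.1]
[cite: Miller2011LMS, §1 and Def. 1.1] -/
theorem missingInputAt_three_of_hasSignedLocalType_IstarZero_of_shaAn_unit
    (W : WeierstrassCurve ℚ) [W.IsElliptic] [W.IsGloballyMinimal] [Fact (Nat.Prime 3)]
    (hT : HasSignedLocalType W 3 (.Istar 0)) (hr : W.analyticRank = 1) {q : ℚ}
    (hq : shaAn W = (q : ℂ)) (hv : padicValRat 3 q = 0) : X12.MissingInputAt W 3 :=
  fun _ ↦ missingPPartAt_of_lower_of_upper W 3 (X12.missingLowerBoundAt_of_shaAn_unit hq hv)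
    (missingUpperBoundAt_three_of_hasSignedLocalType_IstarZero hGZ hKo hMN hGZK hmod hnf hFH hCM8 hMaz W
      hT hr)

end Facts

end Summit.BirchSwinnertonDyer.BirchSwinnertonDyer.Theorems.CccOneManinTwist

end
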